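import Summits.KontsevichZagierPeriods.KontsevichZagierPeriods.Theorems.FurushoPentagonSectorToKernelAdmissibleOfTameSubdivAux

/-!
# `SectorToKernel`, line `effective-cube-surjection`: dyadic subdivision, several coordinates (stub S2)

Helper file for the stub `stub_admissibleOfTame` of the crux `FurushoPentagon.SectorToKernel`
(stmt-KontsevichZagierPeriods-10813), sequel of `…AdmissibleOfTameSubdivAux.lean` (one coordinate).
Here the partial averages over the first `m` coordinates,
`U_{m,N} f (x) = ∑_{k : Fin m → Fin N} N⁻ᵐ f (j < m ? (k_j + x_j)/N : x_j)`, are chained by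
`A_{m,N} ∘ U_{m,N} = U_{m+1,N}` (reindexing by `Fin.snocEquiv`), giving, for `N = 2ʲ`, the equivalence
of a tame cube class with the tame cube class of its full average inside the Kontsevich–Zagier calculus:

  `[[0,1]ⁿ, f] ∼ [[0,1]ⁿ, x ↦ ∑_{k ∈ {0,…,N-1}ⁿ} N⁻ⁿ f ((k + x)/N)]`  (`admOfTame_rel_avg`).

References: M. Kontsevich, D. Zagier, *Periods* (2001), §1.2 rules (1)–(2); J. Ayoub, *Periods and
the conjectures of Grothendieck and Kontsevich–Zagier* (2014), Def. 9 and Rem. 12.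
-/

noncomputable section

namespace Summit.KontsevichZagierPeriods.FurushoPentagon.SectorToKernel

open Set MeasureTheory
open Literature.NumberTheory.Transcendental
open Literature.NumberTheory.Transcendental.KZ hiding cubicalSpan

/-! ## Several coordinates: partial averages over the first `m` coordinates -/

/-- The partially rescaled point `(j < m ? (k_j + x_j)/N : x_j)` lies in the cube. [folklore] -/
theorem admOfTame_partial_mem_cube {n m N : ℕ} (k : Fin m → Fin N) {x : Fin n → ℝ}
    (hx : x ∈ KZ.cube n) :
    (fun j : Fin n => if h : (j : ℕ) < m then ((((k ⟨j, h⟩ : Fin N) : ℕ) : ℝ) + x j) / N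
      else x j) ∈ KZ.cube n := by
  intro j
  by_cases h : (j : ℕ) < m
  · simp only [dif_pos h]
    have hN : (0 : ℝ) < N := by exact_mod_cast (k ⟨j, h⟩).pos
    have hk : (((k ⟨j, h⟩ : Fin N) : ℕ) : ℝ) + 1 ≤ N := by exact_mod_cast (k ⟨j, h⟩).2
    have hk0 : (0 : ℝ) ≤ (((k ⟨j, h⟩ : Fin N) : ℕ) : ℝ) := Nat.cast_nonneg _
    have hxj := KZ.mem_cube.1 hx j
    refine ⟨div_nonneg (by linarith [hxj.1]) hN.le, ?_⟩
    rw [div_le_one hN]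
    linarith [hxj.2]
  · simp only [dif_neg h]
    exact KZ.mem_cube.1 hx j

/-- **Tameness of the partial average** over the first `m` coordinates,
`x ↦ ∑_{k : Fin m → Fin N} N⁻ᵐ f (j < m ? (k_j + x_j)/N : x_j)`. [Bochnak–Coste–Roy 1998, Prop. 2.2.6; folklore] -/
theorem admOfTame_tame_avgU {n : ℕ} (m N : ℕ) {f : (Fin n → ℝ) → ℝ}
    (hf : AnalyticOnNhd ℝ f (KZ.cube n) ∧ IsSemialgebraicFunOn ℚ (KZ.cube n) f) :
    AnalyticOnNhd ℝ (fun x => ∑ k : Fin m → Fin N, ((N : ℝ) ^ m)⁻¹ *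
        f (fun j : Fin n => if h : (j : ℕ) < m then ((((k ⟨j, h⟩ : Fin N) : ℕ) : ℝ) + x j) / N
          else x j)) (KZ.cube n) ∧
      IsSemialgebraicFunOn ℚ (KZ.cube n) (fun x => ∑ k : Fin m → Fin N, ((N : ℝ) ^ m)⁻¹ *
        f (fun j : Fin n => if h : (j : ℕ) < m then ((((k ⟨j, h⟩ : Fin N) : ℕ) : ℝ) + x j) / N
          else x j)) := by
  classical
  refine admOfTame_tame_sum Finset.univ fun k _ => ?_
  refine admOfTame_tame_const_mul ?_ _ (((N : ℚ) ^ m)⁻¹) (by simp)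
  refine admOfTame_tame_comp_polynomialMap hf
    (fun j => if h : (j : ℕ) < m then MvPolynomial.C ((((k ⟨j, h⟩ : Fin N) : ℕ) : ℚ) / N) +
      MvPolynomial.C ((N : ℚ)⁻¹) * MvPolynomial.X j else MvPolynomial.X j) (fun x j => ?_)
    fun x hx => admOfTame_partial_mem_cube k hx
  by_cases h : (j : ℕ) < m
  · simp only [dif_pos h]
    simp
    ring
  · simp only [dif_neg h]
    simp

/-- **Tameness of the full average** `x ↦ ∑_{k ∈ {0,…,N-1}ⁿ} N⁻ⁿ f ((k + x)/N)`.
[Bochnak–Coste–Roy 1998, Prop. 2.2.6; folklore] -/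
theorem admOfTame_tame_avg {n : ℕ} (N : ℕ) {f : (Fin n → ℝ) → ℝ}
    (hf : AnalyticOnNhd ℝ f (KZ.cube n) ∧ IsSemialgebraicFunOn ℚ (KZ.cube n) f) :
    AnalyticOnNhd ℝ (fun x => ∑ k : Fin n → Fin N, ((N : ℝ) ^ n)⁻¹ *
        f (fun j => ((((k j : Fin N) : ℕ) : ℝ) + x j) / N)) (KZ.cube n) ∧
      IsSemialgebraicFunOn ℚ (KZ.cube n) (fun x => ∑ k : Fin n → Fin N, ((N : ℝ) ^ n)⁻¹ *
        f (fun j => ((((k j : Fin N) : ℕ) : ℝ) + x j) / N)) := by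
  classical
  refine admOfTame_tame_sum Finset.univ fun k _ => ?_
  refine admOfTame_tame_const_mul ?_ _ (((N : ℚ) ^ n)⁻¹) (by simp)
  refine admOfTame_tame_comp_polynomialMap hf
    (fun j => MvPolynomial.C ((((k j : Fin N) : ℕ) : ℚ) / N) + MvPolynomial.C ((N : ℚ)⁻¹) *
      MvPolynomial.X j) (fun x j => ?_) fun x hx => ?_
  · simp
    ring
  · have h := admOfTame_partial_mem_cube (m := n) k hx
    convert h using 1
    funext j
    rw [dif_pos j.2]

/-- **Adding one coordinate**: `A_{m,N} (U_{m,N} f) = U_{m+1,N} f`, where `U_{m,N}` is the partial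
average over the first `m` coordinates and `A_{m,N}` the one-coordinate average along the coordinate
`m` (reindexing `k' = Fin.snoc k c`, `Fin.snocEquiv`). [folklore] -/
theorem admOfTame_avgU_succ {n : ℕ} (f : (Fin n → ℝ) → ℝ) {m : ℕ} (hm : m < n) (N : ℕ)
    (hN : 0 < N) (x : Fin n → ℝ) :
    ∑ c : Fin N, (N : ℝ)⁻¹ * ∑ k : Fin m → Fin N, ((N : ℝ) ^ m)⁻¹ *
        f (fun j : Fin n => if h : (j : ℕ) < m then
          ((((k ⟨j, h⟩ : Fin N) : ℕ) : ℝ) +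
            Function.update x ⟨m, hm⟩ ((((c : ℕ) : ℝ) + x ⟨m, hm⟩) / N) j) / N
          else Function.update x ⟨m, hm⟩ ((((c : ℕ) : ℝ) + x ⟨m, hm⟩) / N) j) =
      ∑ k : Fin (m + 1) → Fin N, ((N : ℝ) ^ (m + 1))⁻¹ *
        f (fun j : Fin n => if h : (j : ℕ) < m + 1 then
          ((((k ⟨j, h⟩ : Fin N) : ℕ) : ℝ) + x j) / N else x j) := by
  symm
  rw [← (Fin.snocEquiv fun _ : Fin (m + 1) => Fin N).sum_comp, Fintype.sum_prod_type]
  simp only [Finset.mul_sum]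
  refine Finset.sum_congr rfl fun c _ => Finset.sum_congr rfl fun k _ => ?_
  have hN' : (N : ℝ) ≠ 0 := by exact_mod_cast hN.ne'
  have harg : (fun j : Fin n => if h : (j : ℕ) < m + 1 then
        (((((Fin.snocEquiv fun _ : Fin (m + 1) => Fin N) (c, k) ⟨j, h⟩ : Fin N) : ℕ) : ℝ) + x j) / N
        else x j) =
      fun j : Fin n => if h : (j : ℕ) < m then
        ((((k ⟨j, h⟩ : Fin N) : ℕ) : ℝ) +
          Function.update x ⟨m, hm⟩ ((((c : ℕ) : ℝ) + x ⟨m, hm⟩) / N) j) / N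
        else Function.update x ⟨m, hm⟩ ((((c : ℕ) : ℝ) + x ⟨m, hm⟩) / N) j := by
    funext j
    rcases lt_trichotomy (j : ℕ) m with hj | hj | hj
    · have hjm : j ≠ ⟨m, hm⟩ := fun h => by simp [h] at hj
      rw [dif_pos (Nat.lt_succ_of_lt hj), dif_pos hj, Function.update_of_ne hjm, Fin.snocEquiv_apply]
      have : (⟨(j : ℕ), Nat.lt_succ_of_lt hj⟩ : Fin (m + 1)) = Fin.castSucc ⟨j, hj⟩ := rfl
      rw [this, Fin.snoc_castSucc]
    · have hjm : j = ⟨m, hm⟩ := Fin.ext hj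
      subst hjm
      rw [dif_pos (Nat.lt_succ_self m), dif_neg (lt_irrefl m), Function.update_self,
        Fin.snocEquiv_apply]
      have : (⟨m, Nat.lt_succ_self m⟩ : Fin (m + 1)) = Fin.last m := rfl
      rw [this, Fin.snoc_last]
    · have hjm : j ≠ ⟨m, hm⟩ := fun h => by simp [h] at hj
      rw [dif_neg (by omega), dif_neg (by omega), Function.update_of_ne hjm]
  rw [harg]
  ring

/-- **`[f] ∼ [U_{m,N} f]`** for the partial average over the first `m ≤ n` coordinates, given the
one-coordinate equivalences `[g] ∼ [A_{i,N} g]` (induction on `m`).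
[Kontsevich–Zagier 2001, §1.2 rules (1)–(2); Ayoub 2014, Rem. 12] -/
theorem admOfTame_rel_avgU {n : ℕ} {N : ℕ} (hN : 0 < N)
    (hP : ∀ (i : Fin n) {g B : (Fin n → ℝ) → ℝ}
      (hg : AnalyticOnNhd ℝ g (KZ.cube n) ∧ IsSemialgebraicFunOn ℚ (KZ.cube n) g)
      (hB : AnalyticOnNhd ℝ B (KZ.cube n) ∧ IsSemialgebraicFunOn ℚ (KZ.cube n) B),
      (∀ x, B x = ∑ k : Fin N, (N : ℝ)⁻¹ * g (Function.update x i ((((k : ℕ) : ℝ) + x i) / N))) →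
      of (IntegralRep.tameCube g hg.1 hg.2) - of (IntegralRep.tameCube B hB.1 hB.2) ∈ relations)
    (m : ℕ) : m ≤ n → ∀ {f A : (Fin n → ℝ) → ℝ}
      (hf : AnalyticOnNhd ℝ f (KZ.cube n) ∧ IsSemialgebraicFunOn ℚ (KZ.cube n) f)
      (hA : AnalyticOnNhd ℝ A (KZ.cube n) ∧ IsSemialgebraicFunOn ℚ (KZ.cube n) A),
      (∀ x, A x = ∑ k : Fin m → Fin N, ((N : ℝ) ^ m)⁻¹ *
        f (fun j : Fin n => if h : (j : ℕ) < m then ((((k ⟨j, h⟩ : Fin N) : ℕ) : ℝ) + x j) / N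
          else x j)) →
      of (IntegralRep.tameCube f hf.1 hf.2) - of (IntegralRep.tameCube A hA.1 hA.2) ∈ relations := by
  induction m with
  | zero =>
    intro _ f A hf hA hAeq
    refine admOfTame_rel_congr hf hA fun x _ => ?_
    rw [hAeq x, Fintype.sum_unique]
    simp
  | succ m ih =>
    intro hm f A hf hA hAeq
    have hm' : m < n := hm
    -- partial average over the first `m` coordinates
    have hBt := admOfTame_tame_avgU m N hf
    have h1 := ih hm'.le hf hBt (fun x => rfl)
    -- one more coordinate
    have hCt := admOfTame_tame_avg1 ⟨m, hm'⟩ N hBt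
    have h2 := hP ⟨m, hm'⟩ hBt hCt (fun x => rfl)
    have h3 : of (IntegralRep.tameCube _ hCt.1 hCt.2) - of (IntegralRep.tameCube A hA.1 hA.2) ∈
        relations := by
      refine admOfTame_rel_congr hCt hA fun x _ => ?_
      rw [hAeq x]
      exact admOfTame_avgU_succ f hm' N hN x
    exact admOfTame_rel_trans (admOfTame_rel_trans h1 h2) h3

/-- **Dyadic subdivision of a tame cube class**: for `N = 2ʲ`,
`[[0,1]ⁿ, f] ∼ [[0,1]ⁿ, x ↦ ∑_{k ∈ {0,…,N-1}ⁿ} N⁻ⁿ f ((k + x)/N)]` in the Kontsevich–Zagier calculus.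
[Kontsevich–Zagier 2001, §1.2 rules (1)–(2); Ayoub 2014, Rem. 12] -/
theorem admOfTame_rel_avg {n : ℕ} (j : ℕ) {f A : (Fin n → ℝ) → ℝ}
    (hf : AnalyticOnNhd ℝ f (KZ.cube n) ∧ IsSemialgebraicFunOn ℚ (KZ.cube n) f)
    (hA : AnalyticOnNhd ℝ A (KZ.cube n) ∧ IsSemialgebraicFunOn ℚ (KZ.cube n) A)
    (hAeq : ∀ x, A x = ∑ k : Fin n → Fin (2 ^ j), (((2 ^ j : ℕ) : ℝ) ^ n)⁻¹ *
      f (fun i => ((((k i : Fin (2 ^ j)) : ℕ) : ℝ) + x i) / (2 ^ j : ℕ))) :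
    of (IntegralRep.tameCube f hf.1 hf.2) - of (IntegralRep.tameCube A hA.1 hA.2) ∈ relations := by
  have hN : 0 < 2 ^ j := pow_pos two_pos j
  have hBt := admOfTame_tame_avgU n (2 ^ j) hf
  have h1 := admOfTame_rel_avgU hN (fun i g B hg hB hBeq => admOfTame_rel_avg1_pow i j hg hB hBeq)
    n le_rfl hf hBt (fun x => rfl)
  refine admOfTame_rel_trans h1 (admOfTame_rel_congr hBt hA fun x _ => ?_)
  rw [hAeq x]
  refine Finset.sum_congr rfl fun k _ => ?_
  congr 2
  funext i
  rw [dif_pos i.2]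

/-- **Registered form of `admOfTame_rel_avg`** (all arguments explicit): for `N = 2ʲ`,
`[[0,1]ⁿ, f] ∼ [[0,1]ⁿ, x ↦ ∑_{k ∈ {0,…,N-1}ⁿ} N⁻ⁿ f ((k + x)/N)]` in the Kontsevich–Zagier calculus.
[Kontsevich–Zagier 2001, §1.2 rules (1)–(2); Ayoub 2014, Rem. 12] -/
theorem admOfTame_subdivision :
    ∀ (n : ℕ) (j : ℕ) (f A : (Fin n → ℝ) → ℝ) (hf : AnalyticOnNhd ℝ f (Literature.NumberTheory.Transcendental.KZ.cube n) ∧ Literature.NumberTheory.Transcendental.IsSemialgebraicFunOn ℚ (Literature.NumberTheory.Transcendental.KZ.cube n) f) (hA : AnalyticOnNhd ℝ A (Literature.NumberTheory.Transcendental.KZ.cube n) ∧ Literature.NumberTheory.Transcendental.IsSemialgebraicFunOn ℚ (Literature.NumberTheory.Transcendental.KZ.cube n) A), (∀ x, A x = ∑ k : Fin n → Fin (2 ^ j), (((2 ^ j : ℕ) : ℝ) ^ n)⁻¹ * f (fun i => ((((k i : Fin (2 ^ j)) : ℕ) : ℝ) + x i) / (2 ^ j : ℕ))) → Literature.NumberTheory.Transcendental.KZ.of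 (Literature.NumberTheory.Transcendental.KZ.IntegralRep.tameCube f hf.1 hf.2) - Literature.NumberTheory.Transcendental.KZ.of (Literature.NumberTheory.Transcendental.KZ.IntegralRep.tameCube A hA.1 hA.2) ∈ Literature.NumberTheory.Transcendental.KZ.relations :=
  fun _ j _ _ hf hA hAeq => admOfTame_rel_avg j hf hA hAeq

end Summit.KontsevichZagierPeriods.FurushoPentagon.SectorToKernel
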